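import Summits.Ventures.PercRepro.RankLevelSetPavingBases
import Summits.Ventures.PercRepro.RankLevelSetMinorPairSkewSum

/-! # RankLevelSetBiIndepContainHalfPaving — EVERY PAVING MATROID SATISFIES THE HALF RULE ON EVERY CONTAIN-SET;
HENCE (CX*) ON EVERY DIRECT SUM OF A (CX*)-MATROID AND A PAVING MATROID WITH ANY SPLIT CONTAIN-SET (night-1 g30; dossier §42)

THE HALF RULE for `(M, X)` is the cumulative skew `MinorPairSkew M X ∅ (#E − 2#X)` («the contain-`X` profile is skewed
right about `#E/2`», `α^X_k ≤ α^X_{k'}` for `k < k' ≤ #E − k`); it fails for general matroids (g30 census: 1,042 of the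
70,263,158 `(N, X)` instances on 9 elements, all with `#X ∈ {1, 2}`, none paving) but holds on every paving matroid: the
interior levels are the binomial row `C(#E − #X, k − #X)` (g28), and the only non-binomial comparison is the bottom
level `k = #E − r` against the top `k' = r` (`k + k' = #E`), i.e. **`#{bases avoiding X} ≤ #{bases containing X}`**
(`ncard_bases_disjoint_le_of_paving`, for `#E < 2r`). PROOF by the exchange graph `B ~ B'` iff `B' ∖ X ⊆ B`: a base `B`
avoiding `X` has at least `C(r − 1, #X)` neighbours (`le_ncard_good_of_paving`, `RankLevelSetPavingBases`: the
`(r − #X)`-subsets `S ⊆ B` with `S ∪ X` a base), a base `B' ⊇ X` has at most `C(#E − r, #X) ≤ C(r − 1, #X)` neighbours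
(`B ↦ B ∖ B'` injects into the `#X`-subsets of `E ∖ B'`), so Hall's condition holds by degrees
(`Finset.card_mul_le_card_mul`). Then **`minorPairSkew_half_of_paving : Paving M → ∀ X ⊆ E, MinorPairSkew M X ∅ (#E − 2#X)`**
and, with `RankLevelSetMinorPairSkewSum`, **`biContainSkew_disjointSum_of_paving`**: (CX*)-cum on every contain-set of
`M` and `Paving N` give `BiContainSkew (M ⊕ N)` — the split ⊕-closure of (CX*) with a paving summand — and
**`biContainSkew_disjointSum_paving`** for two paving summands. Every declaration has a docstring; imports: the cell's
own modules and Mathlib only. Axioms: standard. -/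

namespace PercRepro

open Set Matroid

variable {α : Type} (M : Matroid α) [M.Finite]

/-! ## The basis inequality for paving matroids with `#E < 2r` -/

/-- The bases of a finite matroid form a finite family. -/
lemma finite_bases_filter (P : Set α → Prop) : {B : Set α | M.IsBase B ∧ P B}.Finite :=
  M.ground_finite.finite_subsets.subset fun _ hB => hB.1.subset_ground

/-- **The neighbours of a base `B` avoiding `X`** in the exchange graph are the `(r − #X)`-subsets `S ⊆ B` with `S ∪ X`
a base (`B' ↦ B' ∖ X`). -/
lemma ncard_nbhd_avoid_eq {r : ℕ} (hr : M.eRank = r) {X B : Set α} (hX : X ⊆ M.E) (hBX : Disjoint B X) :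
    {B' : Set α | (M.IsBase B' ∧ X ⊆ B') ∧ B' \ X ⊆ B}.ncard =
      {S : Set α | S ⊆ B ∧ S.ncard = r - X.ncard ∧ M.IsBase (S ∪ X)}.ncard := by
  have hXfin : X.Finite := M.ground_finite.subset hX
  refine Set.ncard_congr (fun B' _ => B' \ X) ?_ ?_ ?_
  · rintro B' ⟨⟨hB', hXB'⟩, hsub⟩
    refine ⟨hsub, ?_, by rwa [Set.sdiff_union_of_subset hXB']⟩
    have hcard : B'.ncard = r := by
      have := hB'.encard_eq_eRank
      rw [hr, ← Set.Finite.cast_ncard_eq (M.ground_finite.subset hB'.subset_ground)] at this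
      exact_mod_cast this
    rw [Set.ncard_sdiff hXB' hXfin, hcard]
  · rintro B₁ B₂ ⟨⟨-, hXB₁⟩, -⟩ ⟨⟨-, hXB₂⟩, -⟩ heq
    rw [← Set.sdiff_union_of_subset hXB₁, ← Set.sdiff_union_of_subset hXB₂, heq]
  · rintro S ⟨hSB, -, hSX⟩
    have hdisj : Disjoint S X := hBX.mono_left hSB
    refine ⟨S ∪ X, ⟨⟨hSX, Set.subset_union_right⟩, ?_⟩, ?_⟩
    · rw [Set.union_sdiff_cancel_right (Set.disjoint_iff.mp hdisj)]
      exact hSB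
    · rw [Set.union_sdiff_cancel_right (Set.disjoint_iff.mp hdisj)]

/-- **The neighbours of a base `B' ⊇ X`** are at most `C(#E − r, #X)`: `B ↦ B ∖ B'` injects them into the
`#X`-subsets of `E ∖ B'`. -/
lemma ncard_nbhd_contain_le {r : ℕ} (hr : M.eRank = r) {X B' : Set α} (hX : X ⊆ M.E) (hB' : M.IsBase B')
    (hXB' : X ⊆ B') :
    {B : Set α | (M.IsBase B ∧ Disjoint B X) ∧ B' \ X ⊆ B}.ncard ≤ (M.E.ncard - r).choose X.ncard := by
  have hXfin : X.Finite := M.ground_finite.subset hX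
  have hB'fin : B'.Finite := M.ground_finite.subset hB'.subset_ground
  have hB'card : B'.ncard = r := by
    have := hB'.encard_eq_eRank
    rw [hr, ← Set.Finite.cast_ncard_eq hB'fin] at this
    exact_mod_cast this
  have hEB' : (M.E \ B').Finite := M.ground_finite.subset Set.sdiff_subset
  have htarget : {T : Set α | T ⊆ M.E \ B' ∧ T.ncard = X.ncard}.ncard = (M.E.ncard - r).choose X.ncard := by
    rw [ncard_subsets_of_finite hEB', Set.ncard_sdiff hB'.subset_ground hB'fin, hB'card]
  rw [← htarget]
  -- for a neighbour `B`, `B ∩ B' = B' ∖ X`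
  have hinter : ∀ B : Set α, Disjoint B X → B' \ X ⊆ B → B ∩ B' = B' \ X := by
    intro B hBX hsub
    ext x
    constructor
    · rintro ⟨hxB, hxB'⟩
      exact ⟨hxB', fun hxX => Set.disjoint_left.mp hBX hxB hxX⟩
    · intro hx
      exact ⟨hsub hx, hx.1⟩
  refine Set.ncard_le_ncard_of_injOn (fun B => B \ B') ?_ ?_ (hEB'.finite_subsets.subset fun T hT => hT.1)
  · rintro B ⟨⟨hB, hBX⟩, hsub⟩
    have hBfin : B.Finite := M.ground_finite.subset hB.subset_ground
    have hBcard : B.ncard = r := by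
      have := hB.encard_eq_eRank
      rw [hr, ← Set.Finite.cast_ncard_eq hBfin] at this
      exact_mod_cast this
    refine ⟨Set.sdiff_subset_sdiff_left hB.subset_ground, ?_⟩
    have hcX : X.ncard ≤ r := by rw [← hB'card]; exact Set.ncard_le_ncard hXB' hB'fin
    have h1 := Set.ncard_inter_add_ncard_sdiff_eq_ncard B B' hBfin
    rw [hinter B hBX hsub, Set.ncard_sdiff hXB' hXfin, hB'card, hBcard] at h1
    omega
  · rintro B₁ ⟨⟨-, hB₁X⟩, hsub₁⟩ B₂ ⟨⟨-, hB₂X⟩, hsub₂⟩ heq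
    rw [← Set.inter_union_sdiff B₁ B', ← Set.inter_union_sdiff B₂ B', hinter B₁ hB₁X hsub₁, hinter B₂ hB₂X hsub₂]
    simp only at heq
    rw [heq]

/-- **THE BASIS INEQUALITY FOR PAVING MATROIDS**: if `#E < 2r`, then for every `X ⊆ E`,
`#{bases avoiding X} ≤ #{bases containing X}`. -/
theorem ncard_bases_disjoint_le_of_paving (h : Paving M) {r : ℕ} (hr : M.eRank = r) (hn : M.E.ncard < 2 * r)
    {X : Set α} (hX : X ⊆ M.E) :
    {B : Set α | M.IsBase B ∧ Disjoint B X}.ncard ≤ {B : Set α | M.IsBase B ∧ X ⊆ B}.ncard := by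
  classical
  have hXfin : X.Finite := M.ground_finite.subset hX
  have hXE : X.ncard ≤ M.E.ncard := Set.ncard_le_ncard hX M.ground_finite
  by_cases hcr : r ≤ X.ncard
  · -- no base avoids `X`: it would lie in `E ∖ X`, which has fewer than `r` elements
    have hempty : {B : Set α | M.IsBase B ∧ Disjoint B X} = ∅ := by
      ext B
      simp only [Set.mem_setOf_eq, Set.mem_empty_iff_false, iff_false, not_and]
      intro hB hBX
      have hBfin : B.Finite := M.ground_finite.subset hB.subset_ground
      have hBcard : B.ncard = r := by
        have := hB.encard_eq_eRank
        rw [hr, ← Set.Finite.cast_ncard_eq hBfin] at this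
        exact_mod_cast this
      have hsub : B ⊆ M.E \ X := fun x hx => ⟨hB.subset_ground hx, fun hxX => Set.disjoint_left.mp hBX hx hxX⟩
      have := Set.ncard_le_ncard hsub (M.ground_finite.subset Set.sdiff_subset)
      rw [Set.ncard_sdiff hX hXfin, hBcard] at this
      omega
    rw [hempty, Set.ncard_empty]
    exact Nat.zero_le _
  push Not at hcr
  have hAfin := finite_bases_filter M (fun B => Disjoint B X)
  have hBfin := finite_bases_filter M (fun B => X ⊆ B)
  have hpos : 0 < (r - 1).choose X.ncard := Nat.choose_pos (by omega)
  have hle : (M.E.ncard - r).choose X.ncard ≤ (r - 1).choose X.ncard := Nat.choose_le_choose _ (by omega)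
  -- the double count
  have key := Finset.card_mul_le_card_mul (fun B B' : Set α => B' \ X ⊆ B) (s := hAfin.toFinset) (t := hBfin.toFinset)
    (m := (r - 1).choose X.ncard) (n := (M.E.ncard - r).choose X.ncard) ?_ ?_
  · rw [Set.ncard_eq_toFinset_card _ hAfin, Set.ncard_eq_toFinset_card _ hBfin]
    have h2 : hBfin.toFinset.card * (M.E.ncard - r).choose X.ncard ≤
        hBfin.toFinset.card * (r - 1).choose X.ncard := Nat.mul_le_mul_left _ hle
    exact Nat.le_of_mul_le_mul_right (key.trans h2) hpos
  · -- every base avoiding `X` has at least `C(r − 1, #X)` neighbours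
    intro B hB
    rw [hAfin.mem_toFinset] at hB
    have hcard : (hBfin.toFinset.bipartiteAbove (fun B B' : Set α => B' \ X ⊆ B) B).card =
        {B' : Set α | (M.IsBase B' ∧ X ⊆ B') ∧ B' \ X ⊆ B}.ncard := by
      rw [← Set.ncard_coe_finset]
      congr 1
      ext B'
      simp only [Finset.bipartiteAbove, Finset.coe_filter, hBfin.mem_toFinset, Set.mem_setOf_eq]
    rw [hcard, ncard_nbhd_avoid_eq M hr hX hB.2]
    exact le_ncard_good_of_paving M h hr hB.1 hX hB.2 (by omega)
  · -- every base containing `X` has at most `C(#E − r, #X)` neighbours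
    intro B' hB'
    rw [hBfin.mem_toFinset] at hB'
    have hcard : (hAfin.toFinset.bipartiteBelow (fun B B' : Set α => B' \ X ⊆ B) B').card =
        {B : Set α | (M.IsBase B ∧ Disjoint B X) ∧ B' \ X ⊆ B}.ncard := by
      rw [← Set.ncard_coe_finset]
      congr 1
      ext B
      simp only [Finset.bipartiteBelow, Finset.coe_filter, hAfin.mem_toFinset, Set.mem_setOf_eq]
    rw [hcard]
    exact ncard_nbhd_contain_le M hr hX hB'.1 hB'.2

/-! ## The half rule for paving matroids -/

/-- The bottom level of the contain-`X` profile of a paving matroid with `#E − r < r` counts the bases avoiding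
`X`: `α^X_{#E − r} = #{bases B : Disjoint B X}` (`Z ↦ E ∖ Z`). -/
lemma biContainCount_bottom_of_paving (h : Paving M) {r : ℕ} (hr : M.eRank = r) (hn : M.E.ncard < 2 * r)
    (hrE : r ≤ M.E.ncard) {X : Set α} (hX : X ⊆ M.E) :
    biContainCount M X (M.E.ncard - r) = {B : Set α | M.IsBase B ∧ Disjoint B X}.ncard := by
  unfold biContainCount
  refine Set.ncard_congr (fun Z _ => M.E \ Z) ?_ ?_ ?_
  · rintro Z ⟨⟨hZE, hZcard, -, hZc⟩, hXZ⟩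
    refine ⟨isBase_of_indep_of_ncard M hr hZc ?_, ?_⟩
    · rw [Set.ncard_sdiff hZE (M.ground_finite.subset hZE), hZcard]
      omega
    · rw [Set.disjoint_left]
      intro x hx hxX
      exact hx.2 (hXZ hxX)
  · rintro Z₁ Z₂ ⟨⟨hZ₁E, -, -, -⟩, -⟩ ⟨⟨hZ₂E, -, -, -⟩, -⟩ heq
    have := congrArg (fun T => M.E \ T) heq
    simpa only [Set.sdiff_sdiff_right_self, Set.inter_eq_right.mpr hZ₁E,
      Set.inter_eq_right.mpr hZ₂E] using this
  · rintro B ⟨hB, hBX⟩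
    have hBE := hB.subset_ground
    have hBfin : B.Finite := M.ground_finite.subset hBE
    have hBcard : B.ncard = r := by
      have := hB.encard_eq_eRank
      rw [hr, ← Set.Finite.cast_ncard_eq hBfin] at this
      exact_mod_cast this
    refine ⟨M.E \ B, ⟨⟨Set.sdiff_subset, ?_, ?_, ?_⟩, ?_⟩, ?_⟩
    · rw [Set.ncard_sdiff hBE hBfin, hBcard]
    · refine paving_indep_of_ncard_lt M h hr Set.sdiff_subset ?_
      rw [Set.ncard_sdiff hBE hBfin, hBcard]
      omega
    · rw [Set.sdiff_sdiff_right_self, Set.inter_eq_right.mpr hBE]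
      exact hB.indep
    · exact fun x hx => ⟨hX hx, fun hxB => Set.disjoint_left.mp hBX hxB hx⟩
    · rw [Set.sdiff_sdiff_right_self, Set.inter_eq_right.mpr hBE]

/-- The top level of the contain-`X` profile of a paving matroid with `#E − r < r` counts the bases containing
`X`: `α^X_r = #{bases B : X ⊆ B}`. -/
lemma biContainCount_top_of_paving (h : Paving M) {r : ℕ} (hr : M.eRank = r) (hn : M.E.ncard < 2 * r)
    {X : Set α} (_hX : X ⊆ M.E) :
    biContainCount M X r = {B : Set α | M.IsBase B ∧ X ⊆ B}.ncard := by
  unfold biContainCount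
  congr 1
  ext Z
  simp only [biIndep, Set.mem_setOf_eq]
  constructor
  · rintro ⟨⟨hZE, hZcard, hZ, -⟩, hXZ⟩
    exact ⟨isBase_of_indep_of_ncard M hr hZ hZcard, hXZ⟩
  · rintro ⟨hB, hXZ⟩
    have hZE := hB.subset_ground
    have hZfin : Z.Finite := M.ground_finite.subset hZE
    have hZcard : Z.ncard = r := by
      have := hB.encard_eq_eRank
      rw [hr, ← Set.Finite.cast_ncard_eq hZfin] at this
      exact_mod_cast this
    refine ⟨⟨hZE, hZcard, hB.indep, ?_⟩, hXZ⟩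
    refine paving_indep_of_ncard_lt M h hr Set.sdiff_subset ?_
    rw [Set.ncard_sdiff hZE hZfin, hZcard]
    omega

/-- **EVERY PAVING MATROID SATISFIES THE HALF RULE ON EVERY CONTAIN-SET**: `Paving M → ∀ X ⊆ E,`
`MinorPairSkew M X ∅ (#E − 2#X)`, i.e. `α^X_k ≤ α^X_{k'}` for `k < k' ≤ #E − k`. -/
theorem minorPairSkew_half_of_paving (h : Paving M) : ∀ X ⊆ M.E, MinorPairSkew M X ∅ (M.E.ncard - 2 * X.ncard) := by
  intro X hX i j hij hR
  obtain ⟨r, hr⟩ : ∃ r : ℕ, M.eRank = r := by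
    have := exists_eRk_eq_coe M M.E
    rwa [M.eRk_ground] at this
  have hXE : X.ncard ≤ M.E.ncard := Set.ncard_le_ncard hX M.ground_finite
  -- back to the contain profile at the levels `k = i + #X`, `k' = j + #X`
  have hi := biContainCount_eq_minorPairCount M hX (k := i + X.ncard) (by omega)
  have hj := biContainCount_eq_minorPairCount M hX (k := j + X.ncard) (by omega)
  rw [Nat.add_sub_cancel] at hi hj
  rw [← hi, ← hj]
  set k := i + X.ncard with hk
  set k' := j + X.ncard with hk'
  by_cases hzero : biContainCount M X k = 0
  · rw [hzero]; exact Nat.zero_le _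
  obtain ⟨hck, hrank⟩ := of_biContainCount_ne_zero M hzero
  rw [hr] at hrank
  have hrank' : M.E.ncard - k ≤ r := by exact_mod_cast hrank
  have hk'E : k' ≤ M.E.ncard := by omega
  by_cases htop : k' < r
  · -- interior target level: the full binomial row
    have hk1 : ((k' : ℕ) : ℕ∞) < M.eRank := by rw [hr]; exact_mod_cast htop
    have hk2 : ((M.E.ncard - k' : ℕ) : ℕ∞) < M.eRank := by
      rw [hr]; exact_mod_cast (show M.E.ncard - k' < r by omega)
    calc biContainCount M X k ≤ (M.E.ncard - X.ncard).choose (k - X.ncard) := biContainCount_le_choose M hX hck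
      _ ≤ (M.E.ncard - X.ncard).choose (k' - X.ncard) := choose_le_choose_of_le_of_le_sub (by omega) (by omega)
      _ = biContainCount M X k' := (biContainCount_eq_choose_of_paving M h hX (by omega) hk1 hk2).symm
  · -- the top level `k' = r`, the bottom level `k = #E − r`: the basis inequality
    push Not at htop
    have hk'r : k' = r := by
      -- `k' ≤ #E − k ≤ r`
      omega
    have hkb : k = M.E.ncard - r := by omega
    by_cases hn : M.E.ncard < 2 * r
    · rw [hk'r, hkb, biContainCount_bottom_of_paving M h hr hn (by omega) hX,
        biContainCount_top_of_paving M h hr hn hX]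
      exact ncard_bases_disjoint_le_of_paving M h hr hn hX
    · -- `#E = 2r` forces `k = k'`, excluded by `i < j`
      exfalso
      omega

/-! ## The split ⊕-closure of (CX*) with a paving summand -/

section Sum

variable {N : Matroid α} [N.Finite] {h : Disjoint M.E N.E}

/-- **(CX*) ON `M ⊕ N` FOR A PAVING `N`, WITH EVERY SPLIT CONTAIN-SET**: the cumulative (CX*) on every contain-set of
`M` and `Paving N` give `BiContainSkew (M ⊕ N)`. -/
theorem biContainSkew_disjointSum_of_paving
    (hM : ∀ X ⊆ M.E, MinorPairSkew M X ∅ (M.E.ncard - 2 * X.ncard - 1)) (hN : Paving N) :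
    haveI : (M.disjointSum N h).Finite := ⟨by
      rw [Matroid.disjointSum_ground_eq]; exact M.ground_finite.union N.ground_finite⟩
    BiContainSkew (M.disjointSum N h) :=
  biContainSkew_disjointSum_of_half hM (minorPairSkew_half_of_paving N hN)

/-- **(CX*) ON THE DIRECT SUM OF TWO PAVING MATROIDS WITH EVERY SPLIT CONTAIN-SET.** -/
theorem biContainSkew_disjointSum_paving (hM : Paving M) (hN : Paving N) :
    haveI : (M.disjointSum N h).Finite := ⟨by
      rw [Matroid.disjointSum_ground_eq]; exact M.ground_finite.union N.ground_finite⟩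
    BiContainSkew (M.disjointSum N h) :=
  biContainSkew_disjointSum_of_half
    (fun X hX => minorPairSkew_mono M (minorPairSkew_half_of_paving M hM X hX) (Nat.sub_le _ _))
    (minorPairSkew_half_of_paving N hN)

/-- **The half rule of the sum of two paving matroids** (every split contain-set). -/
theorem minorPairSkew_half_disjointSum_paving (hM : Paving M) (hN : Paving N) :
    ∀ X ⊆ (M.disjointSum N h).E,
      MinorPairSkew (M.disjointSum N h) X ∅ ((M.disjointSum N h).E.ncard - 2 * X.ncard) :=
  minorPairSkew_half_disjointSum (minorPairSkew_half_of_paving M hM) (minorPairSkew_half_of_paving N hN)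

end Sum

end PercRepro
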